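import Mathlib
import HarnessLib
import Literature.Analysis.FluidPDE.CurlIsometryCovariance
import Literature.Analysis.FluidPDE.FlatSwirlGauge
import Summits.NavierStokesRegularity.NavierStokesRegularity.Theorems.PoloidalWindowDoorPoloidalWindowRigidityStrata
import Summits.NavierStokesRegularity.NavierStokesRegularity.Theorems.PoloidalWindowDoorPoloidalWindowRigidityOneSlice

/-!
# Door S11 `LocalTubeDoorHelicity` (nsreg-p1 ROUND-11), profile crux K2⁗ in profile form `FrobeniusProfileRigidity` —
# symmetries of the Frobenius class `𝔉 = {v · curl v ≡ 0}` and its SETTLED STRATA: reduction of the crux to the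
# sharpened residue

Cell ns-regularity-ideate, seat p6 (route-directed support for an UNSTAGED door; anchor
`--supports stmt-NavierStokesRegularity-20018`; edge re-pointed at birth).  The open content of door S11 is the
profile-Liouville statement on the Frobenius class (`…LocalHelicityTubeDoorTarget.localTubeDoorHelicity_of_profileRigidity`).
This file records what the tree already settles INSIDE that class, so that a lead on K2⁗ starts from the honest residue:

* `helicity_conj_linearIsometryEquiv`, `helicityFree_conj_iff` — the helicity density is a PSEUDOSCALAR:
  `⟪(R v R⁻¹)(x), curl (R v R⁻¹)(x)⟫ = det R · ⟪v, curl v⟫(R⁻¹x)` for every linear isometry `R` of `ℝ³`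
  (`curl_conj_linearIsometryEquiv`, `det R = ±1`), so `𝔉` is invariant under ALL of `O(3)` (the poloidal class of K2 is
  not); `helicity_translate` — and under translations (tree `curl_comp_add_const`);
* `eq_zero_of_scaleInvariant_centre` — the scale-invariant (= backward self-similar, Tsai 1998) stratum about ANY
  spatial centre `c` is trivial (tree `…Strata.eq_zero_of_scaleInvariant` after `class_translate`);
* `eq_zero_of_axisymmetric_noSwirl_anyAxis` — axisymmetric WITHOUT swirl about ANY axis (any direction, any centre;
  automatically inside `𝔉`) ⇒ trivial (KNSS 2009 Thm 5.2, tree `…Axisymmetric.eq_zero_of_axisymmetric_noSwirl`, after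
  `class_translate` + `class_conj_linearIsometryEquiv`);
* `frobeniusProfileRigidity_of_sharp` — **K2⁗ (profile form) ⇐ its SHARPENED RESIDUE**: it suffices to exclude
  backward singularity for profiles of the class with `v · curl v ≡ 0` which in addition have, on EVERY slice `s < 0`,
  vorticity parallel to no fixed direction (`∀ b ≠ 0, ∃ y, curl v(s,y) × b ≠ 0` — in particular rotational; tree
  `eq_zero_of_aligned`, item stmt-…-20018) and no translation symmetry along any line (`∀ e ≠ 0, ∃ y l,
  v(s, y + l e) ≠ v(s, y)`; tree `eq_zero_of_translate_eq_slice`, KNSS Thm 5.1 / (N₁)), and which are scale-invariant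
  about no centre, time-periodic with no period (tree `eq_zero_of_timePeriodic`; covers steady), and axisymmetric
  without swirl about no axis.  What is NOT removed (honest): axisymmetric WITH swirl inside `𝔉` (the helicity
  constraint reads `(v_z ∂_r − v_r ∂_z)Γ + Γ ω_θ = 0` for the swirl `Γ = r v_θ`, not `Γ = 0`).

WHAT THIS IS NOT: not a claim about Navier–Stokes regularity and not K2⁗ — bookkeeping of settled strata for a door
route that is not yet staged (bears_on LADDER-NS N0).
-/

noncomputable section

-- the summit and its single sub-problem share the name (CONVENTIONS §1), as in every Theorems file
set_option linter.dupNamespace false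

namespace Summit.NavierStokesRegularity.NavierStokesRegularity.Theorems.LocalHelicityTubeDoorFrobeniusProfileRigidityStrata

open MeasureTheory Set Function Filter Topology TopologicalSpace Metric
open scoped RealInnerProductSpace InnerProductSpace
open Literature.Analysis Literature.Analysis.FluidPDE
open Summit.NavierStokesRegularity.NavierStokesRegularity.Theorems.LocalSineTubeDoorProfileAlignedWindowRigidityAncient
open Summit.NavierStokesRegularity.NavierStokesRegularity.Theorems.LocalSineTubeDoorProfileAlignedWindowRigidity
open Summit.NavierStokesRegularity.NavierStokesRegularity.Theorems.PoloidalWindowDoorPoloidalWindowRigidityWindow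
open Summit.NavierStokesRegularity.NavierStokesRegularity.Theorems.PoloidalWindowDoorPoloidalWindowRigidityFlat
open Summit.NavierStokesRegularity.NavierStokesRegularity.Theorems.PoloidalWindowDoorPoloidalWindowRigidityRotate
open Summit.NavierStokesRegularity.NavierStokesRegularity.Theorems.PoloidalWindowDoorPoloidalWindowRigidityAxisymmetric
open Summit.NavierStokesRegularity.NavierStokesRegularity.Theorems.PoloidalWindowDoorPoloidalWindowRigidityStrata
open Summit.NavierStokesRegularity.NavierStokesRegularity.Theorems.PoloidalWindowDoorPoloidalWindowRigidityOneSlice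

variable {C : ℝ} {v : ℝ → EuclideanSpace ℝ (Fin 3) → EuclideanSpace ℝ (Fin 3)}

/-! ### The helicity density is a pseudoscalar: symmetries of the Frobenius class -/

/-- **Pseudoscalar law of the helicity density**: for a linear isometry `R` of `ℝ³` and any field `V`,
`⟪(R V R⁻¹)(x), curl (R V R⁻¹)(x)⟫ = det R · ⟪V(R⁻¹x), curl V (R⁻¹x)⟫` (`curl (R V R⁻¹) = det R • R (curl V) ∘ R⁻¹`). -/
theorem helicity_conj_linearIsometryEquiv (R : EuclideanSpace ℝ (Fin 3) ≃ₗᵢ[ℝ] EuclideanSpace ℝ (Fin 3))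
    (V : EuclideanSpace ℝ (Fin 3) → EuclideanSpace ℝ (Fin 3)) (x : EuclideanSpace ℝ (Fin 3)) :
    ⟪R (V (R.symm x)), curl (fun y => R (V (R.symm y))) x⟫_ℝ =
      (R : EuclideanSpace ℝ (Fin 3) →L[ℝ] EuclideanSpace ℝ (Fin 3)).det * ⟪V (R.symm x), curl V (R.symm x)⟫_ℝ := by
  rw [curl_conj_linearIsometryEquiv, inner_smul_right, LinearIsometryEquiv.inner_map_map]

/-- **`𝔉` is `O(3)`-invariant**: the helicity density of the conjugated field vanishes at `x` iff that of `V` vanishes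
at `R⁻¹ x` (`det R = ±1`). -/
theorem helicityFree_conj_iff (R : EuclideanSpace ℝ (Fin 3) ≃ₗᵢ[ℝ] EuclideanSpace ℝ (Fin 3))
    (V : EuclideanSpace ℝ (Fin 3) → EuclideanSpace ℝ (Fin 3)) (x : EuclideanSpace ℝ (Fin 3)) :
    ⟪R (V (R.symm x)), curl (fun y => R (V (R.symm y))) x⟫_ℝ = 0 ↔
      ⟪V (R.symm x), curl V (R.symm x)⟫_ℝ = 0 := by
  rw [helicity_conj_linearIsometryEquiv, mul_eq_zero, or_iff_right]
  rcases det_linearIsometryEquiv_eq_one_or_eq_neg_one R with h1 | h1 <;> rw [h1] <;> norm_num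

/-- **`𝔉` is translation-invariant**: the helicity density of `V(· + a)` at `x` is that of `V` at `x + a`. -/
theorem helicity_translate (V : EuclideanSpace ℝ (Fin 3) → EuclideanSpace ℝ (Fin 3)) (a x : EuclideanSpace ℝ (Fin 3)) :
    ⟪V (x + a), curl (fun y => V (y + a)) x⟫_ℝ = ⟪V (x + a), curl V (x + a)⟫_ℝ := by
  rw [curl_comp_add_const]

/-! ### Settled strata about arbitrary centres / axes -/

/-- **The scale-invariant (backward self-similar) stratum about ANY spatial centre is trivial**: if a profile of the
Type-I class satisfies `λ v(λ²s, c + λy) = v(s, c + y)` for all `λ > 0`, `s < 0`, `y`, then `v ≡ 0` on the slab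
(Tsai 1998 via `…Strata.eq_zero_of_scaleInvariant`, applied to the translated profile `v(·, · + c)`). -/
theorem eq_zero_of_scaleInvariant_centre (hrate : HasTypeITimeDecay C v)
    (hcont : ContinuousOn (uncurry v) (Iio (0 : ℝ) ×ˢ univ))
    (hmild : ∀ s t : ℝ, s < t → t < 0 → ∀ x,
      v t x = UnboundedOperators.heatExtension (v s) (t - s) x - oseenDuhamel 1 s v v t x)
    (hdiv : ∀ t < 0, VectorCalculus.IsDivFree (v t)) (c : EuclideanSpace ℝ (Fin 3))
    (hsc : ∀ lam : ℝ, 0 < lam → ∀ s < 0, ∀ y, lam • v (lam ^ 2 * s) (lam • y + c) = v s (y + c)) :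
    ∀ t < 0, ∀ x, v t x = 0 := by
  obtain ⟨hrate', hcont', hmild', hdiv'⟩ := class_translate c hrate hcont hmild hdiv
  have h := eq_zero_of_scaleInvariant hrate' hcont' hmild' hdiv' hsc
  intro t ht x
  have := h t ht (x - c)
  simpa using this

/-- **Axisymmetric WITHOUT swirl about ANY axis ⇒ trivial** (KNSS 2009 Thm 5.2 in the Type-I mild class, tree
`…Axisymmetric.eq_zero_of_axisymmetric_noSwirl`, transported by `class_translate` + `class_conj_linearIsometryEquiv`): if
for some linear isometry `L` and centre `c` every slice of `y ↦ L⁻¹ v(s, L y + c)` is axisymmetric about the `e₃`-axis and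
swirl-free, then `v ≡ 0` on the slab.  (Such profiles have `v · curl v ≡ 0`: they lie in `𝔉`.) -/
theorem eq_zero_of_axisymmetric_noSwirl_anyAxis (hrate : HasTypeITimeDecay C v)
    (hcont : ContinuousOn (uncurry v) (Iio (0 : ℝ) ×ˢ univ))
    (hmild : ∀ s t : ℝ, s < t → t < 0 → ∀ x,
      v t x = UnboundedOperators.heatExtension (v s) (t - s) x - oseenDuhamel 1 s v v t x)
    (hdiv : ∀ t < 0, VectorCalculus.IsDivFree (v t))
    (L : EuclideanSpace ℝ (Fin 3) ≃ₗᵢ[ℝ] EuclideanSpace ℝ (Fin 3)) (c : EuclideanSpace ℝ (Fin 3))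
    (haxi : ∀ s < 0, IsAxisymmetric (fun y => L.symm (v s (L y + c))))
    (hsw : ∀ s < 0, HasNoSwirl (fun y => L.symm (v s (L y + c)))) :
    ∀ t < 0, ∀ x, v t x = 0 := by
  -- the translated, then conjugated profile `w t y = L⁻¹ v(t, L y + c)` is in the class
  obtain ⟨hrate₁, hcont₁, hmild₁, hdiv₁⟩ := class_translate c hrate hcont hmild hdiv
  obtain ⟨hrate₂, hcont₂, hmild₂, hdiv₂⟩ := class_conj_linearIsometryEquiv L.symm hrate₁ hcont₁ hmild₁ hdiv₁
  simp only [LinearIsometryEquiv.symm_symm] at hrate₂ hcont₂ hmild₂ hdiv₂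
  have hw := eq_zero_of_axisymmetric_noSwirl hrate₂ hcont₂ hmild₂ hdiv₂ haxi hsw
  intro t ht x
  have h := hw t ht (L.symm (x - c))
  simp only [LinearIsometryEquiv.apply_symm_apply, sub_add_cancel] at h
  simpa using congrArg L h

/-! ### K2⁗ (profile form) reduced to its sharpened residue -/

/-- **`FrobeniusProfileRigidity` ⇐ its SHARPENED RESIDUE.**  To prove that every profile of the Type-I class (rate,
continuity on the open slab, unit-viscosity Oseen–Duhamel identity, divergence-free slices) with identically vanishing
helicity density is not backward-singular at the apex, it suffices to treat the profiles which IN ADDITION have, on every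
slice `s < 0`, vorticity parallel to no fixed direction (in particular are rotational) and no translation symmetry along
any line, and which are scale-invariant about no centre, time-periodic with no period, and axisymmetric-without-swirl
about no axis — every excluded alternative is a settled stratum (tree theorems `eq_zero_of_aligned`,
`eq_zero_of_translate_eq_slice`, `eq_zero_of_scaleInvariant_centre`, `eq_zero_of_timePeriodic`,
`eq_zero_of_axisymmetric_noSwirl_anyAxis`). -/
theorem frobeniusProfileRigidity_of_sharp
    (hsharp : ∀ (C : ℝ) (v : ℝ → EuclideanSpace ℝ (Fin 3) → EuclideanSpace ℝ (Fin 3)),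
      Literature.Analysis.FluidPDE.HasTypeITimeDecay C v →
      ContinuousOn (Function.uncurry v) (Set.Iio (0 : ℝ) ×ˢ Set.univ) →
      (∀ s t : ℝ, s < t → t < 0 → ∀ x, v t x =
        Literature.Analysis.UnboundedOperators.heatExtension (v s) (t - s) x -
          Literature.Analysis.FluidPDE.oseenDuhamel 1 s v v t x) →
      (∀ t < 0, Literature.Analysis.FluidPDE.VectorCalculus.IsDivFree (v t)) →
      (∀ s < 0, ∀ y : EuclideanSpace ℝ (Fin 3), ⟪v s y, Literature.Analysis.FluidPDE.curl (v s) y⟫_ℝ = 0) →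
      -- vorticity parallel to no fixed direction, on every slice (in particular: rotational)
      (∀ s < 0, ∀ b : EuclideanSpace ℝ (Fin 3), b ≠ 0 →
        ∃ y, Literature.Analysis.FluidPDE.cross (Literature.Analysis.FluidPDE.curl (v s) y) b ≠ 0) →
      -- no translation symmetry along any line, on every slice
      (∀ s < 0, ∀ e : EuclideanSpace ℝ (Fin 3), e ≠ 0 → ∃ (y : EuclideanSpace ℝ (Fin 3)) (l : ℝ),
        v s (y + l • e) ≠ v s y) →
      -- scale-invariant (backward self-similar) about no centre
      (∀ c : EuclideanSpace ℝ (Fin 3), ∃ lam : ℝ, 0 < lam ∧ ∃ s < 0, ∃ y,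
        lam • v (lam ^ 2 * s) (lam • y + c) ≠ v s (y + c)) →
      -- time-periodic with no period (in particular: not steady)
      (∀ P : ℝ, 0 < P → ∃ s < 0, ∃ y, v (s - P) y ≠ v s y) →
      -- axisymmetric without swirl about no axis
      (∀ (L : EuclideanSpace ℝ (Fin 3) ≃ₗᵢ[ℝ] EuclideanSpace ℝ (Fin 3)) (c : EuclideanSpace ℝ (Fin 3)),
        ¬ ((∀ s < 0, Literature.Analysis.FluidPDE.IsAxisymmetric (fun y => L.symm (v s (L y + c)))) ∧
           (∀ s < 0, Literature.Analysis.FluidPDE.HasNoSwirl (fun y => L.symm (v s (L y + c)))))) →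
      ¬ Literature.Analysis.FluidPDE.IsBackwardSingularPoint v 0) :
    ∀ (C : ℝ) (v : ℝ → EuclideanSpace ℝ (Fin 3) → EuclideanSpace ℝ (Fin 3)),
    Literature.Analysis.FluidPDE.HasTypeITimeDecay C v →
    ContinuousOn (Function.uncurry v) (Set.Iio (0 : ℝ) ×ˢ Set.univ) →
    (∀ s t : ℝ, s < t → t < 0 → ∀ x, v t x =
      Literature.Analysis.UnboundedOperators.heatExtension (v s) (t - s) x -
        Literature.Analysis.FluidPDE.oseenDuhamel 1 s v v t x) →
    (∀ t < 0, Literature.Analysis.FluidPDE.VectorCalculus.IsDivFree (v t)) →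
    (∀ s < 0, ∀ y : EuclideanSpace ℝ (Fin 3), ⟪v s y, Literature.Analysis.FluidPDE.curl (v s) y⟫_ℝ = 0) →
    ¬ Literature.Analysis.FluidPDE.IsBackwardSingularPoint v 0 := by
  intro C v hrate hcont hmild hdiv hhel
  -- (1) a slice with unidirectional (possibly zero) vorticity
  by_cases h1 : ∃ s < 0, ∃ b : EuclideanSpace ℝ (Fin 3), b ≠ 0 ∧ ∀ y, cross (curl (v s) y) b = 0
  · obtain ⟨s, hs, b, hb, hal⟩ := h1
    exact not_backwardSingular_of_zero (eq_zero_of_aligned hrate hcont hmild hdiv hb hs hal)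
  -- (2) a slice with a translation symmetry along a line
  by_cases h2 : ∃ s < 0, ∃ e : EuclideanSpace ℝ (Fin 3), e ≠ 0 ∧ ∀ (y : EuclideanSpace ℝ (Fin 3)) (l : ℝ),
      v s (y + l • e) = v s y
  · obtain ⟨s, hs, e, he, htr⟩ := h2
    exact nonflatLiouville_of_translate_eq_slice hrate hcont hmild hdiv hs he htr
  -- (3) scale-invariant about some centre
  by_cases h3 : ∃ c : EuclideanSpace ℝ (Fin 3), ∀ lam : ℝ, 0 < lam → ∀ s < 0, ∀ y,
      lam • v (lam ^ 2 * s) (lam • y + c) = v s (y + c)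
  · obtain ⟨c, hsc⟩ := h3
    exact not_backwardSingular_of_zero (eq_zero_of_scaleInvariant_centre hrate hcont hmild hdiv c hsc)
  -- (4) time-periodic
  by_cases h4 : ∃ P : ℝ, 0 < P ∧ ∀ s < 0, ∀ y, v (s - P) y = v s y
  · obtain ⟨P, hP, hper⟩ := h4
    exact nonflatLiouville_of_timePeriodic hrate hP hper
  -- (5) axisymmetric without swirl about some axis
  by_cases h5 : ∃ (L : EuclideanSpace ℝ (Fin 3) ≃ₗᵢ[ℝ] EuclideanSpace ℝ (Fin 3)) (c : EuclideanSpace ℝ (Fin 3)),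
      (∀ s < 0, IsAxisymmetric (fun y => L.symm (v s (L y + c)))) ∧
      (∀ s < 0, HasNoSwirl (fun y => L.symm (v s (L y + c))))
  · obtain ⟨L, c, haxi, hsw⟩ := h5
    exact not_backwardSingular_of_zero
      (eq_zero_of_axisymmetric_noSwirl_anyAxis hrate hcont hmild hdiv L c haxi hsw)
  -- (6) the sharpened residue
  push Not at h1 h2 h3 h4
  refine hsharp C v hrate hcont hmild hdiv hhel (fun s hs b hb => h1 s hs b hb) (fun s hs e he => ?_)
    (fun c => ?_) (fun P hP => h4 P hP) (fun L c hax => h5 ⟨L, c, hax⟩)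
  · obtain ⟨y, l, h⟩ := h2 s hs e he
    exact ⟨y, l, h⟩
  · obtain ⟨lam, hlam, s, hs, y, h⟩ := h3 c
    exact ⟨lam, hlam, s, hs, y, h⟩

end Summit.NavierStokesRegularity.NavierStokesRegularity.Theorems.LocalHelicityTubeDoorFrobeniusProfileRigidityStrata

end
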